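import Mathlib
import Summits.KontsevichZagierPeriods.KontsevichZagierPeriods.Theorems.InverseLandauTateFamilyKernelRationalCertificate
import Summits.KontsevichZagierPeriods.KontsevichZagierPeriods.Theorems.InverseLandauTateFamilyKernelStubEulerDivergence
import Summits.KontsevichZagierPeriods.KontsevichZagierPeriods.Theorems.HermiteRigidityIslandComplementCubeReflection

/-!
# Crux `TateFamilyKernel` (stmt-KontsevichZagierPeriods-9130), line `Sketch`:
# stub `stub_eulerFaces` (wave 12, Euler sector — the divergence theorem on the 3-cube)

Step (B) of the Euler sector in the lead's skeleton of the crux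
`Summit.KontsevichZagierPeriods.KontsevichZagierPeriods.Theses.InverseLandau.TateFamilyKernel`.
Data: weights `a, b`, a pencil `Q = 1 − ϖT` with `T ∈ ℚ[z₀,z₁]` weighted-homogeneous of degree
`d`, a numerator `P₀` weighted-homogeneous of degree `w`, `λ = w + a + b`, a real-algebraic `ϖ₀`,
and the reparametrisation `ϖ = ϖ₀t^d`. The 4-variable data are `X 0, X 1 = z`, `X 2 = t`,
`X 3 ↦ ϖ₀` (lifts `rename (Fin.castLE _)`, evaluation `aeval (Fin.snoc x ϖ₀)` on `[0,1]³`); the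
3-variable face data are `X 0 = s`, `X 1 = t`, `X 2 ↦ ϖ₀`.

Statement (`stub_eulerFaces`): for every tame cube `r` on `[0,1]³` with integrand
`t^{λ−1}·(λP₀Q + dϖP₀T)/Q²` at `ϖ = ϖ₀t^d` and every tame cube `rb` on `[0,1]²` with integrand
`t^{λ−1}·[aP₀(1,s)·Q_b + bP₀(s,1)·Q_a]/(Q_a·Q_b)`, `Q_a = 1 − ϖ₀t^dT(1,s)`, `Q_b = 1 − ϖ₀t^dT(s,1)`,
the difference `[r] − [rb]` lies in `KZ.relations`.

Proof (divergence theorem on the 3-cube, as two Ayoub elements):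
* `EulerFaces.integrand_identity` — by the weighted Euler identities
  (`EulerDivergence.euler_aeval`, the content of the landed `stub_eulerDivergence`),
  `r`'s integrand is `∂₀K₀ + ∂₁K₁` on the cube, `K₀ = t^{λ−1}a z₀P₀/Q`, `K₁ = t^{λ−1}b z₁P₀/Q`
  (Griffiths form of the `zᵢ`-derivatives, `hasDerivAt_slice_update`);
* `EulerFaces.exists_stokes_pair` — one Stokes move along a cube coordinate for polynomial data
  whose `zᵢ = 0` face vanishes (`tame_stokesAt` of the `TameRelA` toolkit, the zero face being a
  relation by `KZ.of_mem_relations_of_eqOn_zero`): `[□³, ∂ᵢKᵢ] ≡ [□², Kᵢ|_{zᵢ=1}]`;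
* `EulerFaces.face_identity` — the two `zᵢ = 1` faces, read in the remaining variables `(s, t)`
  (`Fin.insertNth` keeps them in order; the coordinate bookkeeping `insertNth_*_apply_*` is the
  landed one of `HermiteRigidityIslandComplementCubeReflection`), add up to `rb`'s integrand over
  the common denominator;
* integrand additivity (`KZ.mem_cubicalLinGens`) splits `[r]` and `[rb]` accordingly.

References: Kontsevich–Zagier 2001, §1.2 rules (1)–(3); Ayoub, EMS Newsl. 91 (2014), Def. 10.
Mathlib plus landed sibling files; no named fact, no new definition. Helpers live in the
sub-namespace `EulerFaces`. The hypotheses `0 < d`, `1 ≤ λ` of the registered signature are not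
needed for this step (the weight `t^{λ−1}` is a common factor, constant in `z`).
-/

noncomputable section

open MeasureTheory Set MvPolynomial
open Literature.NumberTheory.Transcendental
open Summit.KontsevichZagierPeriods.HermiteRigidity.ReductionRigidity (insertNth_zero_apply_one
  insertNth_zero_apply_two insertNth_one_apply_zero insertNth_one_apply_two)

namespace Summit.KontsevichZagierPeriods.InverseLandau.TateFamilyKernel.Descent

namespace EulerFaces

/-! ### Evaluation of the 4-variable data at `(x, ϖ₀)`, `x ∈ ℝ³` -/

/-- Coordinate `0` of the point `Fin.snoc x ϖ` (`x ∈ ℝ³`) is `x 0`. [folklore] -/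
theorem snoc_apply_zero (x : Fin 3 → ℝ) (ϖ : ℝ) : (Fin.snoc x ϖ : Fin (3 + 1) → ℝ) 0 = x 0 := rfl

/-- Coordinate `1` of the point `Fin.snoc x ϖ` (`x ∈ ℝ³`) is `x 1`. [folklore] -/
theorem snoc_apply_one (x : Fin 3 → ℝ) (ϖ : ℝ) : (Fin.snoc x ϖ : Fin (3 + 1) → ℝ) 1 = x 1 := rfl

/-- Coordinate `2` (the variable `t`) of the point `Fin.snoc x ϖ` (`x ∈ ℝ³`) is `x 2`. [folklore] -/
theorem snoc_apply_two (x : Fin 3 → ℝ) (ϖ : ℝ) : (Fin.snoc x ϖ : Fin (3 + 1) → ℝ) 2 = x 2 := rfl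

/-- Coordinate `3` (the parameter slot) of the point `Fin.snoc x ϖ` (`x ∈ ℝ³`) is `ϖ`. [folklore] -/
theorem snoc_apply_three (x : Fin 3 → ℝ) (ϖ : ℝ) : (Fin.snoc x ϖ : Fin (3 + 1) → ℝ) 3 = ϖ := rfl

/-- The 4-variable lift of `F ∈ ℚ[z₀,z₁]` evaluated at `(x, ϖ)`: `F(x 0, x 1)`. [folklore] -/
theorem aeval_snoc_rename_castLE (F : MvPolynomial (Fin 2) ℚ) (x : Fin 3 → ℝ) (ϖ : ℝ) :
    aeval (Fin.snoc x ϖ : Fin (3 + 1) → ℝ) (rename (Fin.castLE (show 2 ≤ 4 by norm_num)) F) =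
      aeval ![x 0, x 1] F := by
  have h : (Fin.snoc x ϖ : Fin (3 + 1) → ℝ) ∘ Fin.castLE (show 2 ≤ 4 by norm_num) = ![x 0, x 1] := by
    funext j
    fin_cases j <;> rfl
  rw [aeval_rename, h]

/-- Evaluating a two-slot substitution: `(bind₁ (f₀, f₁) F)(v) = F(f₀(v), f₁(v))`. [folklore] -/
theorem aeval_bind₁_pair {σ : Type*} (v : σ → ℝ) (f₀ f₁ : MvPolynomial σ ℚ)
    (F : MvPolynomial (Fin 2) ℚ) :
    aeval v (bind₁ ![f₀, f₁] F) = aeval ![aeval v f₀, aeval v f₁] F := by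
  have h : (fun i => aeval v ((![f₀, f₁] : Fin 2 → MvPolynomial σ ℚ) i)) =
      ![aeval v f₀, aeval v f₁] := by
    funext j
    fin_cases j <;> simp
  rw [aeval_bind₁, h]

/-- `∂₀` commutes with the 4-variable lift `rename (Fin.castLE _)`. [folklore] -/
theorem pderiv_zero_rename_castLE (F : MvPolynomial (Fin 2) ℚ) :
    pderiv (0 : Fin (3 + 1)) (rename (Fin.castLE (show 2 ≤ 4 by norm_num)) F) =
      rename (Fin.castLE (show 2 ≤ 4 by norm_num)) (pderiv 0 F) :=
  pderiv_rename (Fin.castLE_injective (show 2 ≤ 4 by norm_num)) (0 : Fin 2) F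

/-- `∂₁` commutes with the 4-variable lift `rename (Fin.castLE _)`. [folklore] -/
theorem pderiv_one_rename_castLE (F : MvPolynomial (Fin 2) ℚ) :
    pderiv (1 : Fin (3 + 1)) (rename (Fin.castLE (show 2 ≤ 4 by norm_num)) F) =
      rename (Fin.castLE (show 2 ≤ 4 by norm_num)) (pderiv 1 F) :=
  pderiv_rename (Fin.castLE_injective (show 2 ≤ 4 by norm_num)) (1 : Fin 2) F

/-! ### The divergence identity on the 3-cube -/

/-- **`r`'s integrand is a divergence.** With `K₀ = t^n·a z₀P₀/Q`, `K₁ = t^n·b z₁P₀/Q`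
(`Q = 1 − X₃X₂^dT`, 4-variable data) and `Q(x, ϖ₀) ≠ 0`:
`t^n(λP₀Q + dϖ₀t^dP₀T)/Q² = ∂₀K₀ + ∂₁K₁` at `(x, ϖ₀)`, both partials in Griffiths form
`(∂ᵢAᵢ·Q − Aᵢ·∂ᵢQ)/Q²`. The quotient rule plus the weighted Euler identities
`a z₀∂₀P₀ + b z₁∂₁P₀ = wP₀`, `a z₀∂₀T + b z₁∂₁T = dT` (`EulerDivergence.euler_aeval`).
[cite: KontsevichZagier2001, §1.2] -/
theorem integrand_identity (a b d n w : ℕ) {T P₀ : MvPolynomial (Fin 2) ℚ}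
    (hT : T.IsWeightedHomogeneous (![a, b] : Fin 2 → ℕ) d)
    (hP : P₀.IsWeightedHomogeneous (![a, b] : Fin 2 → ℕ) w) (ϖ₀ : ℝ) (x : Fin 3 → ℝ)
    (hq : aeval (Fin.snoc x ϖ₀ : Fin (3 + 1) → ℝ)
      (1 - X 3 * X 2 ^ d * rename (Fin.castLE (show 2 ≤ 4 by norm_num)) T) ≠ 0) :
    aeval (Fin.snoc x ϖ₀ : Fin (3 + 1) → ℝ)
          (X 2 ^ n *
            (C ((w + a + b : ℕ) : ℚ) * rename (Fin.castLE (show 2 ≤ 4 by norm_num)) P₀ *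
                (1 - X 3 * X 2 ^ d * rename (Fin.castLE (show 2 ≤ 4 by norm_num)) T) +
              C ((d : ℕ) : ℚ) * X 3 * X 2 ^ d * rename (Fin.castLE (show 2 ≤ 4 by norm_num)) P₀ *
                rename (Fin.castLE (show 2 ≤ 4 by norm_num)) T)) /
        aeval (Fin.snoc x ϖ₀ : Fin (3 + 1) → ℝ)
          ((1 - X 3 * X 2 ^ d * rename (Fin.castLE (show 2 ≤ 4 by norm_num)) T) ^ 2) =
      aeval (Fin.snoc x ϖ₀ : Fin (3 + 1) → ℝ)
          (pderiv (Fin.castSucc (0 : Fin 3))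
              (X 2 ^ n * (C (a : ℚ) * X 0 * rename (Fin.castLE (show 2 ≤ 4 by norm_num)) P₀)) *
              (1 - X 3 * X 2 ^ d * rename (Fin.castLE (show 2 ≤ 4 by norm_num)) T) -
            X 2 ^ n * (C (a : ℚ) * X 0 * rename (Fin.castLE (show 2 ≤ 4 by norm_num)) P₀) *
              pderiv (Fin.castSucc (0 : Fin 3))
                (1 - X 3 * X 2 ^ d * rename (Fin.castLE (show 2 ≤ 4 by norm_num)) T)) /
        aeval (Fin.snoc x ϖ₀ : Fin (3 + 1) → ℝ)
          ((1 - X 3 * X 2 ^ d * rename (Fin.castLE (show 2 ≤ 4 by norm_num)) T) ^ 2) +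
      aeval (Fin.snoc x ϖ₀ : Fin (3 + 1) → ℝ)
          (pderiv (Fin.castSucc (1 : Fin 3))
              (X 2 ^ n * (C (b : ℚ) * X 1 * rename (Fin.castLE (show 2 ≤ 4 by norm_num)) P₀)) *
              (1 - X 3 * X 2 ^ d * rename (Fin.castLE (show 2 ≤ 4 by norm_num)) T) -
            X 2 ^ n * (C (b : ℚ) * X 1 * rename (Fin.castLE (show 2 ≤ 4 by norm_num)) P₀) *
              pderiv (Fin.castSucc (1 : Fin 3))
                (1 - X 3 * X 2 ^ d * rename (Fin.castLE (show 2 ≤ 4 by norm_num)) T)) /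
        aeval (Fin.snoc x ϖ₀ : Fin (3 + 1) → ℝ)
          ((1 - X 3 * X 2 ^ d * rename (Fin.castLE (show 2 ≤ 4 by norm_num)) T) ^ 2) := by
  -- the two weighted Euler identities at `z = (x 0, x 1)`
  have eP := EulerDivergence.euler_aeval hP ![x 0, x 1]
  have eT := EulerDivergence.euler_aeval hT ![x 0, x 1]
  simp only [Matrix.cons_val_zero, Matrix.cons_val_one] at eP eT
  have h20 : (2 : Fin (3 + 1)) ≠ 0 := by decide
  have h30 : (3 : Fin (3 + 1)) ≠ 0 := by decide
  have h21 : (2 : Fin (3 + 1)) ≠ 1 := by decide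
  have h31 : (3 : Fin (3 + 1)) ≠ 1 := by decide
  have hq2 : aeval (Fin.snoc x ϖ₀ : Fin (3 + 1) → ℝ)
      ((1 - X 3 * X 2 ^ d * rename (Fin.castLE (show 2 ≤ 4 by norm_num)) T) ^ 2) ≠ 0 := by
    rw [map_pow]; exact pow_ne_zero 2 hq
  rw [← add_div, div_left_inj' hq2]
  -- polynomial level: the quotient-rule data
  simp only [Fin.castSucc_zero, Fin.castSucc_one, pderiv_mul, Derivation.leibniz_pow,
    pderiv_X_of_ne h20, pderiv_X_of_ne h30, pderiv_X_of_ne h21, pderiv_X_of_ne h31, pderiv_X_self,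
    pderiv_C, map_sub, pderiv_one, pderiv_zero_rename_castLE, pderiv_one_rename_castLE, smul_zero,
    zero_mul, zero_add, mul_one, mul_zero, add_zero, zero_sub]
  -- evaluate at `(x, ϖ₀)`
  simp only [map_sub, map_add, map_mul, map_pow, map_one, map_neg, map_natCast, aeval_X,
    snoc_apply_zero, snoc_apply_one, snoc_apply_two, snoc_apply_three, aeval_snoc_rename_castLE,
    Nat.cast_add] at hq ⊢
  linear_combination (-(x 2 ^ n * (1 - ϖ₀ * x 2 ^ d * aeval ![x 0, x 1] T))) * eP +
    (-(x 2 ^ n * ϖ₀ * x 2 ^ d * aeval ![x 0, x 1] P₀)) * eT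

/-! ### The two `zᵢ = 1` faces add up to the face band -/

/-- **Face identity.** At `y = (s, t) ∈ ℝ²`: `rb`'s integrand
`t^n[aP₀(1,s)Q_b + bP₀(s,1)Q_a]/(Q_aQ_b)` equals `K₀(1,s,t) + K₁(s,1,t)`, the `z₀ = 1` face of
`K₀ = t^n a z₀P₀/Q` plus the `z₁ = 1` face of `K₁ = t^n b z₁P₀/Q` (face points
`Fin.insertNth 0 1 y = (1, s, t)`, `Fin.insertNth 1 1 y = (s, 1, t)`), provided `Q_a, Q_b ≠ 0`.
[cite: KontsevichZagier2001, §1.2] -/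
theorem face_identity (a b d n : ℕ) (T P₀ : MvPolynomial (Fin 2) ℚ) (ϖ₀ : ℝ) (y : Fin 2 → ℝ)
    (hqa : aeval (Fin.snoc (Fin.insertNth (0 : Fin 3) 1 y) ϖ₀ : Fin (3 + 1) → ℝ)
      (1 - X 3 * X 2 ^ d * rename (Fin.castLE (show 2 ≤ 4 by norm_num)) T) ≠ 0)
    (hqb : aeval (Fin.snoc (Fin.insertNth (1 : Fin 3) 1 y) ϖ₀ : Fin (3 + 1) → ℝ)
      (1 - X 3 * X 2 ^ d * rename (Fin.castLE (show 2 ≤ 4 by norm_num)) T) ≠ 0) :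
    aeval (Fin.snoc y ϖ₀ : Fin (2 + 1) → ℝ)
          (X 1 ^ n *
            (C (a : ℚ) * bind₁ ![C 1, X 0] P₀ * (1 - X 2 * X 1 ^ d * bind₁ ![X 0, C 1] T) +
              C (b : ℚ) * bind₁ ![X 0, C 1] P₀ * (1 - X 2 * X 1 ^ d * bind₁ ![C 1, X 0] T))) /
        aeval (Fin.snoc y ϖ₀ : Fin (2 + 1) → ℝ)
          ((1 - X 2 * X 1 ^ d * bind₁ ![C 1, X 0] T) * (1 - X 2 * X 1 ^ d * bind₁ ![X 0, C 1] T)) =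
      aeval (Fin.snoc (Fin.insertNth (0 : Fin 3) 1 y) ϖ₀ : Fin (3 + 1) → ℝ)
          (X 2 ^ n * (C (a : ℚ) * X 0 * rename (Fin.castLE (show 2 ≤ 4 by norm_num)) P₀)) /
        aeval (Fin.snoc (Fin.insertNth (0 : Fin 3) 1 y) ϖ₀ : Fin (3 + 1) → ℝ)
          (1 - X 3 * X 2 ^ d * rename (Fin.castLE (show 2 ≤ 4 by norm_num)) T) +
      aeval (Fin.snoc (Fin.insertNth (1 : Fin 3) 1 y) ϖ₀ : Fin (3 + 1) → ℝ)
          (X 2 ^ n * (C (b : ℚ) * X 1 * rename (Fin.castLE (show 2 ≤ 4 by norm_num)) P₀)) /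
        aeval (Fin.snoc (Fin.insertNth (1 : Fin 3) 1 y) ϖ₀ : Fin (3 + 1) → ℝ)
          (1 - X 3 * X 2 ^ d * rename (Fin.castLE (show 2 ≤ 4 by norm_num)) T) := by
  simp only [map_sub, map_add, map_mul, map_pow, map_one, map_natCast, aeval_X,
    snoc_apply_zero, snoc_apply_one, snoc_apply_two, snoc_apply_three, aeval_snoc_rename_castLE,
    Fin.insertNth_apply_same, insertNth_zero_apply_one, insertNth_zero_apply_two,
    insertNth_one_apply_zero, insertNth_one_apply_two, aeval_bind₁_pair,
    EulerDivergence.snoc_apply_zero, EulerDivergence.snoc_apply_one,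
    EulerDivergence.snoc_apply_two] at hqa hqb ⊢
  rw [div_add_div _ _ hqa hqb, div_eq_div_iff (mul_ne_zero hqa hqb) (mul_ne_zero hqa hqb)]
  ring

/-! ### One Stokes move with vanishing `0`-face -/

/-- **An Ayoub element whose `zᵢ = 0` face vanishes.** For `ℚ`-polynomial data `A/Q` in the
three cube variables and the parameter (evaluated at a real-algebraic `ϖ₀`), with `Q(·, ϖ₀) ≠ 0`
on `[0,1]³` and `A(·, ϖ₀) = 0` on the face `zᵢ = 0`, there are tame cubes
`R = [□³, ∂ᵢ(A/Q)(·, ϖ₀)]` (Griffiths form) and `F = [□², (A/Q)(·, ϖ₀)|_{zᵢ=1}]` with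
`[R] − [F] ∈ KZ.relations` (`tame_stokesAt`; the zero face is a relation by
`KZ.of_mem_relations_of_eqOn_zero`). [cite: Ayoub2014, Def. 10] [cite: KontsevichZagier2001, §1.2] -/
theorem exists_stokes_pair (i : Fin 3) (A Q : MvPolynomial (Fin (3 + 1)) ℚ) {ϖ₀ : ℝ}
    (halg : IsAlgebraic ℚ ϖ₀)
    (hQ : ∀ x ∈ KZ.cube 3, aeval (Fin.snoc x ϖ₀ : Fin (3 + 1) → ℝ) Q ≠ 0)
    (hA0 : ∀ y ∈ KZ.cube 2, aeval (Fin.snoc (Fin.insertNth i 0 y) ϖ₀ : Fin (3 + 1) → ℝ) A = 0) :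
    ∃ R : KZ.IntegralRep 3, R.IsTameCube ∧
      (∀ x ∈ KZ.cube 3, R.integrand x =
        aeval (Fin.snoc x ϖ₀ : Fin (3 + 1) → ℝ)
            (pderiv (Fin.castSucc i) A * Q - A * pderiv (Fin.castSucc i) Q) /
          aeval (Fin.snoc x ϖ₀ : Fin (3 + 1) → ℝ) (Q ^ 2)) ∧
      ∃ F : KZ.IntegralRep 2, F.IsTameCube ∧
        (∀ y ∈ KZ.cube 2, F.integrand y =
          aeval (Fin.snoc (Fin.insertNth i 1 y) ϖ₀ : Fin (3 + 1) → ℝ) A /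
            aeval (Fin.snoc (Fin.insertNth i 1 y) ϖ₀ : Fin (3 + 1) → ℝ) Q) ∧
        KZ.of R - KZ.of F ∈ KZ.relations := by
  have hQ2 : ∀ x ∈ KZ.cube 3, aeval (Fin.snoc x ϖ₀ : Fin (3 + 1) → ℝ) (Q ^ 2) ≠ 0 :=
    fun x hx => by rw [map_pow]; exact pow_ne_zero 2 (hQ x hx)
  have h1c : ((1 : ℚ) : ℝ) ∈ Icc (0 : ℝ) 1 := by norm_num
  -- the slice `G = (A/Q)(·, ϖ₀)` and its tame derived data
  set G : (Fin 3 → ℝ) → ℝ := fun x =>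
    aeval (Fin.snoc x ϖ₀ : Fin (3 + 1) → ℝ) A / aeval (Fin.snoc x ϖ₀ : Fin (3 + 1) → ℝ) Q with hG
  have hGa : AnalyticOnNhd ℝ G (KZ.cube 3) := analyticOnNhd_slice A Q ϖ₀ hQ
  have hGs : IsSemialgebraicFunOn ℚ (KZ.cube 3) G := isSemialgebraicFunOn_slice A Q halg hQ
  set R : KZ.IntegralRep 3 := KZ.IntegralRep.tameCube _ (analyticOnNhd_slice _ _ ϖ₀ hQ2)
    (isSemialgebraicFunOn_slice (pderiv (Fin.castSucc i) A * Q - A * pderiv (Fin.castSucc i) Q)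
      (Q ^ 2) halg hQ2) with hR
  set F : KZ.IntegralRep 2 := KZ.IntegralRep.tameCube (fun y => G (Fin.insertNth i 1 y))
    (analyticOnNhd_comp_insertNth hGa i ⟨zero_le_one, le_rfl⟩)
    (by simpa using isSemialgebraicFunOn_comp_insertNth hGs i (c := 1) h1c) with hF
  -- the zero face
  obtain ⟨Z, hZd, hZi⟩ := KZ.exists_zeroRep (KZ.isSemialgebraic_cube (n := 2))
  have hZ : Z.IsTameCube := ⟨hZd, by rw [hZi]; exact analyticOnNhd_const⟩
  have hZrel : KZ.of Z ∈ KZ.relations := KZ.of_mem_relations_of_eqOn_zero Z (by simp [hZi, EqOn])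
  -- Stokes along `i`
  have hst : KZ.of R - (KZ.of F - KZ.of Z) ∈ KZ.relations :=
    tame_stokesAt i hGa hGs (fun x hx => hasDerivAt_slice_update A Q ϖ₀ i x (hQ x hx)) R
      (KZ.IntegralRep.isTameCube_tameCube _ _ _) (fun x _ => by simp [hR]) F Z
      (KZ.IntegralRep.isTameCube_tameCube _ _ _) hZ (fun y _ => by simp [hF])
      (fun y hy => by simp [hZi, hG, hA0 y hy])
  refine ⟨R, KZ.IntegralRep.isTameCube_tameCube _ _ _, fun x _ => by simp [hR], F,
    KZ.IntegralRep.isTameCube_tameCube _ _ _, fun y _ => by simp [hF, hG], ?_⟩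
  have : KZ.of R - KZ.of F = (KZ.of R - (KZ.of F - KZ.of Z)) - KZ.of Z := by abel
  rw [this]
  exact KZ.relations.sub_mem hst hZrel

end EulerFaces

/-- STUB `stub_eulerFaces` (wave 12 — (B) EULER FACES: divergence theorem on the 3-cube). With
`r` the tame cube of `t^{λ−1}·(λP₀Q + dϖP₀T)/Q²` at `ϖ = ϖ₀t^d` and `T, P₀` weighted-homogeneous
(weights `a, b`, degrees `d, w`): `r`'s integrand equals `∂_{z₀}(t^{λ−1}a z₀P₀/Q) + ∂_{z₁}(t^{λ−1}b z₁P₀/Q)`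
(`EulerFaces.integrand_identity`), so two Ayoub elements reduce `[r]` to the `zᵢ = 1` faces (the
`zᵢ = 0` faces vanish, `EulerFaces.exists_stokes_pair`); for every tame cube `rb` in the variables
`(s, t)` with integrand `t^{λ−1}·[aP₀(1,s)/(1−ϖT(1,s)) + bP₀(s,1)/(1−ϖT(s,1))]`, `ϖ = ϖ₀t^d`
(common denominator, `EulerFaces.face_identity`), `[r] − [rb] ∈ KZ.relations`.
[cite: KontsevichZagier2001, §1.2] [cite: Ayoub2014, Def. 10] -/
theorem stub_eulerFaces (a b d w : ℕ) (hd : 0 < d) (hl : 1 ≤ w + a + b) (T P₀ : MvPolynomial (Fin 2) ℚ)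
    (hT : T.IsWeightedHomogeneous (![a, b] : Fin 2 → ℕ) d) (hP : P₀.IsWeightedHomogeneous (![a, b] : Fin 2 → ℕ) w)
    (ϖ₀ : ℝ) (halg : IsAlgebraic ℚ ϖ₀)
    (hadm : ∀ x ∈ KZ.cube 3, aeval (Fin.snoc x ϖ₀ : Fin (3 + 1) → ℝ)
      (1 - X 3 * X 2 ^ d * rename (Fin.castLE (show 2 ≤ 4 by norm_num)) T) ≠ 0)
    (r : KZ.IntegralRep 3) (hr : r.IsTameCube)
    (hri : ∀ x ∈ KZ.cube 3, r.integrand x =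
      aeval (Fin.snoc x ϖ₀ : Fin (3 + 1) → ℝ)
          (X 2 ^ (w + a + b - 1) *
            (C ((w + a + b : ℕ) : ℚ) * rename (Fin.castLE (show 2 ≤ 4 by norm_num)) P₀ *
                (1 - X 3 * X 2 ^ d * rename (Fin.castLE (show 2 ≤ 4 by norm_num)) T) +
              C ((d : ℕ) : ℚ) * X 3 * X 2 ^ d * rename (Fin.castLE (show 2 ≤ 4 by norm_num)) P₀ *
                rename (Fin.castLE (show 2 ≤ 4 by norm_num)) T)) /
        aeval (Fin.snoc x ϖ₀ : Fin (3 + 1) → ℝ)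
          ((1 - X 3 * X 2 ^ d * rename (Fin.castLE (show 2 ≤ 4 by norm_num)) T) ^ 2))
    (rb : KZ.IntegralRep 2) (hrb : rb.IsTameCube)
    (hrbi : ∀ y ∈ KZ.cube 2, rb.integrand y =
      aeval (Fin.snoc y ϖ₀ : Fin (2 + 1) → ℝ)
          (X 1 ^ (w + a + b - 1) *
            (C (a : ℚ) * bind₁ ![C 1, X 0] P₀ * (1 - X 2 * X 1 ^ d * bind₁ ![X 0, C 1] T) +
              C (b : ℚ) * bind₁ ![X 0, C 1] P₀ * (1 - X 2 * X 1 ^ d * bind₁ ![C 1, X 0] T))) /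
        aeval (Fin.snoc y ϖ₀ : Fin (2 + 1) → ℝ)
          ((1 - X 2 * X 1 ^ d * bind₁ ![C 1, X 0] T) * (1 - X 2 * X 1 ^ d * bind₁ ![X 0, C 1] T))) :
    KZ.of r - KZ.of rb ∈ KZ.relations := by
  -- `hd`, `hl` belong to the registered signature but are not needed for this step
  have _ := hd
  have _ := hl
  have h1c : (1 : ℝ) ∈ Icc (0 : ℝ) 1 := ⟨zero_le_one, le_rfl⟩
  -- the two Ayoub elements, directions `z₀` and `z₁`
  obtain ⟨R₀, hR₀, hR₀i, F₀, hF₀, hF₀i, h₀⟩ := EulerFaces.exists_stokes_pair 0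
    (X 2 ^ (w + a + b - 1) * (C (a : ℚ) * X 0 * rename (Fin.castLE (show 2 ≤ 4 by norm_num)) P₀))
    (1 - X 3 * X 2 ^ d * rename (Fin.castLE (show 2 ≤ 4 by norm_num)) T) halg hadm
    (fun y _ => by
      simp only [map_mul, aeval_X, EulerFaces.snoc_apply_zero, Fin.insertNth_apply_same, mul_zero,
        zero_mul])
  obtain ⟨R₁, hR₁, hR₁i, F₁, hF₁, hF₁i, h₁⟩ := EulerFaces.exists_stokes_pair 1
    (X 2 ^ (w + a + b - 1) * (C (b : ℚ) * X 1 * rename (Fin.castLE (show 2 ≤ 4 by norm_num)) P₀))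
    (1 - X 3 * X 2 ^ d * rename (Fin.castLE (show 2 ≤ 4 by norm_num)) T) halg hadm
    (fun y _ => by
      simp only [map_mul, aeval_X, EulerFaces.snoc_apply_one, Fin.insertNth_apply_same, mul_zero,
        zero_mul])
  -- `[r] ≡ [R₀] + [R₁]`: the divergence identity
  have hsr : KZ.of r - KZ.of R₀ - KZ.of R₁ ∈ KZ.relations :=
    KZ.cubicalLinGens_subset_relations (KZ.mem_cubicalLinGens hr hR₀ hR₁ fun x hx => by
      rw [Pi.add_apply, hri x hx, hR₀i x hx, hR₁i x hx]
      exact EulerFaces.integrand_identity a b d (w + a + b - 1) w hT hP ϖ₀ x (hadm x hx))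
  -- `[rb] ≡ [F₀] + [F₁]`: the face identity
  have hsb : KZ.of rb - KZ.of F₀ - KZ.of F₁ ∈ KZ.relations :=
    KZ.cubicalLinGens_subset_relations (KZ.mem_cubicalLinGens hrb hF₀ hF₁ fun y hy => by
      rw [Pi.add_apply, hrbi y hy, hF₀i y hy, hF₁i y hy]
      exact EulerFaces.face_identity a b d (w + a + b - 1) T P₀ ϖ₀ y
        (hadm _ (insertNth_mem_cube 0 h1c hy)) (hadm _ (insertNth_mem_cube 1 h1c hy)))
  have : KZ.of r - KZ.of rb = (KZ.of r - KZ.of R₀ - KZ.of R₁) + (KZ.of R₀ - KZ.of F₀) +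
      (KZ.of R₁ - KZ.of F₁) - (KZ.of rb - KZ.of F₀ - KZ.of F₁) := by abel
  rw [this]
  exact KZ.relations.sub_mem (KZ.relations.add_mem (KZ.relations.add_mem hsr h₀) h₁) hsb

end Summit.KontsevichZagierPeriods.InverseLandau.TateFamilyKernel.Descent

end
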